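import Summits.ValiantsHypothesis.ValiantsHypothesis.Theorems.MonotoneRestorationOrbitRestorationQPSymmetricModel
import Summits.ValiantsHypothesis.ValiantsHypothesis.Theorems.MonotoneRestorationOrbitRestorationQPSymmetricModelTwisted
import HarnessLib

/-!
# Route MonotoneRestoration — crux `OrbitRestorationQP` (stmt-ValiantsHypothesis-18293), line `depth_three_rung`:
# the symmetric-model sub-rung of `A_∞` — SIGN-STABLE LINEAR FRAMES RESTORE from the invariance of `e_d(Λ)` alone

Helper file (`--supports stmt-ValiantsHypothesis-18293`), def-free.  Namespace
`Summit.ValiantsHypothesis.ValiantsHypothesis.Theorems.OrbitRestorationQPDepthThreeRung.SymmetricModel` (continued).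

A linear frame `Λ = (ℓ_{w_i})_{i<m}` is SIGN-STABLE if every matrix renaming `x_pq ↦ x_{σ p, τ q}` maps the multiset `Λ`
either to itself or to `−Λ` (the analogue, inside Shpilka's symmetric model, of the twisted factor multisets met by the
landed A₁ — e.g. the Vandermonde-type frames `{x_P − x_Q}`).  On such frames the symmetric-model rung holds with its OWN
hypothesis:

* `map_esymm_eq` — ring homomorphisms commute with `Multiset.esymm`; `esymm_map_neg` — `e_d(−Λ) = (−1)^d e_d(Λ)`;
* `moment_map_of_frame_map` — on a sign-stable frame every moment is a relative invariant:
  `g · p_j(Λ) = p_j(Λ)` or `g · p_j(Λ) = (−1)^j p_j(Λ)`;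
* ★ `qpOrbitRestorable_esymm_of_signStable` — **SIGN-STABLE FRAMES RESTORE**: for every `c` there is `c'` such that for
  all `n`, every sign-stable linear frame `Λ` of `≤ n^c + c` forms, every `d` and `a`: if `e_d(Λ)` is matrix-symmetric then
  `a · e_d(Λ)` is `QPOrbitRestorable c' n`.  (Even `d`: even moments and products of odd moments are invariant, so
  `qpOrbitRestorable_esymm_of_evenOddMoments'` applies — here the invariance of `e_d` is automatic; odd `d`: either the
  frame is stable on the nose (kind (S), `qpOrbitRestorable_esymm_of_matrixStable`) or some renaming negates it, and then
  `e_d(Λ) = −e_d(Λ) = 0`.)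
* `symmetricModel_of_signStable` — family form.

Honest label: a sub-rung theorem; no registered stub is closed; A_∞, the crux and VP ≠ VNP are NOT moved.

## References
* A. Shpilka, *Affine projections of symmetric polynomials*, J. Comput. System Sci. 65 (2002) 639–659, Thm 3.1. [Shpilka2002]
* A. Dawar, G. Wilsenach, *Symmetric arithmetic circuits*, ToC 21 (2025), §3.3 (ORB). [DawarWilsenach2025]
-/

noncomputable section

open scoped Classical

-- `Summit.ValiantsHypothesis.ValiantsHypothesis.…` is the tree's single-conjunct layout (Sub = Summit).
set_option linter.dupNamespace false

namespace Summit.ValiantsHypothesis.ValiantsHypothesis.Theorems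

namespace OrbitRestorationQPDepthThreeRung

namespace SymmetricModel

open MvPolynomial Finset Equiv WaringJennrich LevelStructure ProductAction

variable {n : ℕ}

/-! ### Elementary symmetric polynomials under ring maps and negation -/

/-- Algebra endomorphisms commute with `Multiset.esymm`: `φ (e_d(Y)) = e_d(φ Y)`. [folklore] -/
theorem map_esymm_eq (φ : MvPolynomial (Fin n × Fin n) ℂ →ₐ[ℂ] MvPolynomial (Fin n × Fin n) ℂ)
    (Y : Multiset (MvPolynomial (Fin n × Fin n) ℂ)) (d : ℕ) :
    φ (Y.esymm d) = (Y.map φ).esymm d := by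
  rw [Multiset.esymm, Multiset.esymm, map_multiset_sum, Multiset.map_map, Multiset.powersetCard_map, Multiset.map_map]
  congr 1
  refine Multiset.map_congr rfl fun t _ => ?_
  simp only [Function.comp_apply, map_multiset_prod]

/-- `e_d(−Y) = (−1)^d · e_d(Y)`. [folklore] -/
theorem esymm_map_neg (Y : Multiset (MvPolynomial (Fin n × Fin n) ℂ)) (d : ℕ) :
    (Y.map fun y => -y).esymm d = C ((-1 : ℂ) ^ d) * Y.esymm d := by
  have h := Multiset.pow_smul_esymm (-1 : ℂ) d Y
  rw [← smul_eq_C_mul, h]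
  congr 2
  funext y
  rw [neg_one_smul]

/-- **Moments of a sign-stable frame are relative invariants**: if a renaming `φ` maps the frame `Λ` to `Λ` or to `−Λ`,
then `φ (p_j(Λ)) = p_j(Λ)` or `φ (p_j(Λ)) = (−1)^j p_j(Λ)` respectively. [folklore] -/
theorem moment_map_of_frame_map {m : ℕ} (φ : MvPolynomial (Fin n × Fin n) ℂ →ₐ[ℂ] MvPolynomial (Fin n × Fin n) ℂ)
    (v : Fin m → MvPolynomial (Fin n × Fin n) ℂ) (s : ℂ)
    (h : ((univ : Finset (Fin m)).val.map v).map φ = ((univ : Finset (Fin m)).val.map v).map fun y => C s * y)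
    (j : ℕ) : φ (∑ i : Fin m, v i ^ j) = C (s ^ j) * ∑ i : Fin m, v i ^ j := by
  have h2 := congrArg (fun M : Multiset (MvPolynomial (Fin n × Fin n) ℂ) => (M.map fun y => y ^ j).sum) h
  simp only [Multiset.map_map, Function.comp_def] at h2
  rw [map_sum]
  simp only [map_pow]
  rw [Finset.sum_eq_multiset_sum, h2, ← Finset.sum_eq_multiset_sum, Finset.mul_sum]
  refine Finset.sum_congr rfl fun i _ => ?_
  rw [mul_pow, ← map_pow]

/-! ### Sign-stable frames restore -/

/-- `Y ↦ C 1 · Y` is the identity on multisets. [folklore] -/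
theorem map_C_one_mul (Y : Multiset (MvPolynomial (Fin n × Fin n) ℂ)) :
    Y.map (fun y => C (1 : ℂ) * y) = Y := by
  have h : (fun y : MvPolynomial (Fin n × Fin n) ℂ => C (1 : ℂ) * y) = id := by
    funext y; rw [map_one, one_mul, id]
  rw [h, Multiset.map_id]

/-- `C (-1) · y = -y` on multisets. [folklore] -/
theorem map_C_neg_one_mul (Y : Multiset (MvPolynomial (Fin n × Fin n) ℂ)) :
    Y.map (fun y => C (-1 : ℂ) * y) = Y.map fun y => -y :=
  Multiset.map_congr rfl fun y _ => by rw [map_neg, map_one, neg_one_mul]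

/-- A polynomial over `ℂ` equal to its own negative vanishes. [folklore] -/
theorem eq_zero_of_eq_neg_self {e : MvPolynomial (Fin n × Fin n) ℂ} (he : e = -e) : e = 0 := by
  have h2 : (2 : MvPolynomial (Fin n × Fin n) ℂ) * e = 0 := by
    rw [two_mul]
    nth_rewrite 2 [he]
    rw [add_neg_cancel]
  exact (mul_eq_zero.mp h2).resolve_left two_ne_zero

/-- ★ **SIGN-STABLE LINEAR FRAMES RESTORE FROM THE INVARIANCE OF `e_d` ALONE (uniform constant).**  For every `c` there is
`c'` such that at every level `n`, for every linear frame `Λ = (ℓ_{w_i})_{i<m}` with `m ≤ n^c + c` which every matrix renaming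
maps, as a multiset, to `Λ` or to `−Λ`, every `d` and every `a`: if `e_d(Λ)` is matrix-symmetric then `a · e_d(Λ)` is
`QPOrbitRestorable c' n`. [folklore; cite: Shpilka2002, Thm 3.1] -/
theorem qpOrbitRestorable_esymm_of_signStable (c : ℕ) : ∃ c' : ℕ, ∀ (n m : ℕ)
    (w : Fin m → (Fin n × Fin n) → ℂ) (a : ℂ) (d : ℕ), m ≤ n ^ c + c →
    (∀ σ τ : Perm (Fin n),
      ((univ : Finset (Fin m)).val.map fun i => lin (w i)).map (rename fun q : Fin n × Fin n => (σ q.1, τ q.2)) =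
          ((univ : Finset (Fin m)).val.map fun i => lin (w i)) ∨
        ((univ : Finset (Fin m)).val.map fun i => lin (w i)).map (rename fun q : Fin n × Fin n => (σ q.1, τ q.2)) =
          ((univ : Finset (Fin m)).val.map fun i => lin (w i)).map fun y => -y) →
    (∀ σ τ : Perm (Fin n), rename (fun q : Fin n × Fin n => (σ q.1, τ q.2))
      ((((univ : Finset (Fin m)).val.map fun i => lin (w i)).esymm d)) =
        ((univ : Finset (Fin m)).val.map fun i => lin (w i)).esymm d) →
    QPOrbitRestorable c' n (C a * (((univ : Finset (Fin m)).val.map fun i => lin (w i)).esymm d)) := by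
  obtain ⟨c₁, hc₁⟩ := qpOrbitRestorable_esymm_of_matrixStable c
  obtain ⟨c₂, hc₂⟩ := qpOrbitRestorable_esymm_of_evenOddMoments' c
  refine ⟨max c₁ c₂, fun n m w a d hm hstab hsym => ?_⟩
  -- the moments are relative invariants with sign `1` or `-1`
  have hmom : ∀ σ τ : Perm (Fin n), ∃ s : ℂ, (s = 1 ∨ s = -1) ∧ ∀ j : ℕ,
      rename (fun q : Fin n × Fin n => (σ q.1, τ q.2)) (∑ i : Fin m, lin (w i) ^ j) =
        C (s ^ j) * ∑ i : Fin m, lin (w i) ^ j := by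
    intro σ τ
    rcases hstab σ τ with h | h
    · refine ⟨1, Or.inl rfl, fun j => moment_map_of_frame_map _ (fun i => lin (w i)) 1 ?_ j⟩
      rw [map_C_one_mul]; exact h
    · refine ⟨-1, Or.inr rfl, fun j => moment_map_of_frame_map _ (fun i => lin (w i)) (-1) ?_ j⟩
      rw [map_C_neg_one_mul]; exact h
  by_cases hall : ∀ σ τ : Perm (Fin n),
      ((univ : Finset (Fin m)).val.map fun i => lin (w i)).map (rename fun q : Fin n × Fin n => (σ q.1, τ q.2)) =
        ((univ : Finset (Fin m)).val.map fun i => lin (w i))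
  · -- stable on the nose: kind (S)
    refine Restorable.qpOrbitRestorable_mono (le_max_left _ _) (hc₁ n _ a d ?_ ?_ hall)
    · intro y hy
      obtain ⟨i, -, rfl⟩ := Multiset.mem_map.mp hy
      exact (isHomogeneous_lin (w i)).totalDegree_le
    · rw [Multiset.card_map, Finset.card_val, Finset.card_univ, Fintype.card_fin]
      exact hm
  · obtain ⟨σ₀, hσ₀⟩ := not_forall.mp hall
    obtain ⟨τ₀, hne⟩ := not_forall.mp hσ₀
    have hneg := (hstab σ₀ τ₀).resolve_left hne
    rcases Nat.even_or_odd d with hd | hd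
    · -- even degree: even moments and products of odd moments are invariant
      refine Restorable.qpOrbitRestorable_mono (le_max_right _ _) (hc₂ n m w a d hm hd ?_ ?_)
      · intro j hj _ _ σ τ
        obtain ⟨s, hs, hsj⟩ := hmom σ τ
        rw [hsj j]
        rcases hs with rfl | rfl
        · rw [one_pow, map_one, one_mul]
        · rw [hj.neg_one_pow, map_one, one_mul]
      · intro j j' hj hj' _ _ σ τ
        obtain ⟨s, hs, hsj⟩ := hmom σ τ
        rw [map_mul, hsj j, hsj j', mul_mul_mul_comm, ← map_mul, ← pow_add]
        rcases hs with rfl | rfl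
        · rw [one_pow, map_one, one_mul]
        · rw [(Odd.add_odd hj hj').neg_one_pow, map_one, one_mul]
    · -- odd degree: `e_d(Λ) = -e_d(Λ) = 0`
      have hzero : (((univ : Finset (Fin m)).val.map fun i => lin (w i)).esymm d) = 0 := by
        have h := hsym σ₀ τ₀
        rw [map_esymm_eq, hneg, esymm_map_neg, hd.neg_one_pow, map_neg, map_one, neg_one_mul] at h
        exact eq_zero_of_eq_neg_self h.symm
      rw [hzero, mul_zero]
      have h := hc₁ n 0 0 0 (fun y hy => absurd hy (Multiset.notMem_zero y)) (by simp) (fun σ τ => by simp)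
      rw [map_zero, zero_mul] at h
      exact Restorable.qpOrbitRestorable_mono (le_max_left _ _) h

/-- **THE SYMMETRIC-MODEL RUNG HOLDS ON SIGN-STABLE LINEAR FRAMES (family form)** — the rung's own hypothesis (matrix
symmetry of the family) suffices on this class. [folklore; cite: Shpilka2002, Thm 3.1] -/
theorem symmetricModel_of_signStable :
    ∀ f : (n : ℕ) → MvPolynomial (Fin n × Fin n) ℂ, IsMatrixSymmetric f →
      (∃ c : ℕ, ∀ n : ℕ, ∃ (m : ℕ) (w : Fin m → (Fin n × Fin n) → ℂ) (a : ℂ) (d : ℕ),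
        m ≤ n ^ c + c ∧
        (∀ σ τ : Perm (Fin n),
          ((univ : Finset (Fin m)).val.map fun i => lin (w i)).map (rename fun q : Fin n × Fin n => (σ q.1, τ q.2)) =
              ((univ : Finset (Fin m)).val.map fun i => lin (w i)) ∨
            ((univ : Finset (Fin m)).val.map fun i => lin (w i)).map (rename fun q : Fin n × Fin n => (σ q.1, τ q.2)) =
              ((univ : Finset (Fin m)).val.map fun i => lin (w i)).map fun y => -y) ∧
        f n = C a * (((univ : Finset (Fin m)).val.map fun i => lin (w i)).esymm d)) →
      ∃ c : ℕ, ∀ n : ℕ, QPOrbitRestorable c n (f n) := by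
  intro f hsym hf
  obtain ⟨c, hc⟩ := hf
  obtain ⟨c', hc'⟩ := qpOrbitRestorable_esymm_of_signStable c
  refine ⟨c', fun n => ?_⟩
  obtain ⟨m, w, a, d, hm, hstab, hfn⟩ := hc n
  rw [hfn]
  by_cases ha : a = 0
  · subst ha
    have hz : (((univ : Finset (Fin m)).val.map fun i => lin (w i)).esymm (m + 1)) = 0 := by
      rw [Multiset.esymm, Multiset.powersetCard_eq_empty (m + 1)
        (by rw [Multiset.card_map, Finset.card_val, Finset.card_univ, Fintype.card_fin]; omega)]
      simp
    have h := hc' n m w 0 (m + 1) hm hstab (fun σ τ => by rw [hz, map_zero])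
    rw [map_zero, zero_mul] at h ⊢
    exact h
  · refine hc' n m w a d hm hstab fun σ τ => ?_
    have hs := hsym n σ τ
    rw [hfn, map_mul, rename_C] at hs
    exact mul_left_cancel₀ ((map_ne_zero_iff C (C_injective _ _)).2 ha) hs

end SymmetricModel

end OrbitRestorationQPDepthThreeRung

end Summit.ValiantsHypothesis.ValiantsHypothesis.Theorems

end
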